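import Mathlib
import HarnessLib
import Literature.Dynamics.Hyperbolic.RGFlowStableManifoldSecondDiff

/-!
# The fine-tuning theorem with norm-bound predicates, IV: iteration and limit of the second-difference
# contraction; first differences of BOTH coordinates ([ABKM19] Thm 12.1, smoothness content)

Continuation of `RGFlowStableManifoldSecondDiff.lean` (`distQ2_step_rel`, `distQ2_step_irrel`).

* `RGFlow.distQ_le_of_isTunedQ` — the first-difference bound `Δ/(1−κ)·η^k` for the relevant AND the
  irrelevant coordinates (the latter needs the predicates to be closed from above in the bound,
  `hQc`, which holds for every "‖y‖ ≤ c"-type predicate);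
* `RGFlow.distQ2_step`, `RGFlow.distQ2_iterate` — the combined second-difference step and its
  iteration from the trivial bound `4ε`: after `n` steps the weighted mixed second difference is at most
  `κ^n·4ε + Δ₂/(1−κ)`;
* **`RGFlow.secondDiff_le_of_isTunedQ`** — the limit: `‖x^{11}_k − x^{10}_k − x^{01}_k + x^{00}_k‖ ≤ Δ₂/(1−κ)·η^k`
  and the same for the irrelevant coordinates, `Δ₂ = secondPertSize …` bilinear in the first-order data.

Everything is proved; no named fact.

## References
* S. Adams, S. Buchholz, R. Kotecký, S. Müller, arXiv:1910.13564, Ch. 12: Theorem 12.1,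
  (12.43)–(12.49) [AdamsBuchholzKoteckyMuller2019].
* D. C. Brydges, IAS/Park City Math. Ser. 16 (2009), §2.10, Theorem 2.16 [Brydges2009].
-/

noncomputable section

open Set Function Metric Filter
open scoped NNReal Topology

namespace Literature.Dynamics.Hyperbolic

namespace RGFlow

variable {E : ℕ → Type*} [∀ k, NormedAddCommGroup (E k)] [∀ k, NormedSpace ℝ (E k)]
  {F : ℕ → Type*} [∀ k, AddCommGroup (F k)]

/-! ## §10 First differences of both coordinates -/

section firstBoth

variable {N : ℕ} {r α β σ η κ ε a b l m : ℝ} {Q : ∀ k, F k → ℝ → Prop}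
  {A A' : ∀ k, E k ≃L[ℝ] E (k + 1)} {B B' : ∀ k, F k →+ E (k + 1)}
  {S S' : ∀ k, E k → F k → F (k + 1)} {y₀ y₀' : F 0} {x x' : ∀ k, E k}

/-- **First differences of both coordinates** ([ABKM19] Thm 12.1, continuity content): for predicates
closed from above in the bound (`hQc`), the tuned trajectories of two nearby systems satisfy
`‖x_k − x'_k‖ ≤ η^k Δ/(1−κ)` and `‖y_k − y'_k‖_k ≤ η^k Δ/(1−κ)`, `Δ = pertSize α β η ε a b l m`.
[cite: AdamsBuchholzKoteckyMuller2019, Thm 12.1] -/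
theorem distQ_le_of_isTunedQ (hQ : IsSubaddNormBound Q)
    (hQc : ∀ k (y : F k) (c : ℝ), (∀ c', c < c' → Q k y c') → Q k y c)
    (hT : IsRGStepQ N r α β σ Q A B S)
    (hη : 0 < η) (hη1 : η ≤ 1) (hα : 0 ≤ α) (hβ : 0 ≤ β) (hκ₁ : α * (η + β) ≤ κ)
    (hκ₂ : σ ≤ κ * η) (hκ : κ < 1) (hε : 0 ≤ ε) (hεr : ε ≤ r)
    (htr : IsTunedQ N A B S y₀ x) (htr' : IsTunedQ N A' B' S' y₀' x')
    (htu : InTubeQ N η ε Q S y₀ x) (htu' : InTubeQ N η ε Q S' y₀' x')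
    (ha0 : 0 ≤ a) (hl0 : 0 ≤ l)
    (ha : ∀ k, k < N → ∀ w : E (k + 1), ‖(A k).symm w - (A' k).symm w‖ ≤ a * ‖w‖)
    (hb : ∀ k, k < N → ∀ (v : F k) (c : ℝ), Q k v c → ‖B k v - B' k v‖ ≤ b * c)
    (hl : ∀ k, k < N → ∀ (u : E k) (v : F k) (c : ℝ), ‖u‖ ≤ r → Q k v c → c ≤ r →
      Q (k + 1) (S k u v - S' k u v) (l * max ‖u‖ c))
    (hm : Q 0 (y₀ - y₀') m) :
    ∀ k, k ≤ N → ‖x k - x' k‖ ≤ pertSize α β η ε a b l m / (1 - κ) * η ^ k ∧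
      Q k (fwd S y₀ x k - fwd S' y₀' x' k) (pertSize α β η ε a b l m / (1 - κ) * η ^ k) := by
  set Δ := pertSize α β η ε a b l m with hΔ
  have hκ0 : 0 ≤ κ := le_trans (mul_nonneg hα (add_nonneg hη.le hβ)) hκ₁
  intro k hk
  refine ⟨norm_sub_le_of_isTunedQ hQ hT hη hη1 hα hβ hκ₁ hκ₂ hκ hε hεr htr htr' htu htu' ha0 hl0
    ha hb hl hm k hk, hQc _ _ _ fun c' hc' => ?_⟩
  have hlim : Tendsto (fun n : ℕ => (κ ^ n * (2 * ε) + Δ / (1 - κ)) * η ^ k) atTop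
      (𝓝 ((0 * (2 * ε) + Δ / (1 - κ)) * η ^ k)) :=
    (((tendsto_pow_atTop_nhds_zero_of_lt_one hκ0 hκ).mul_const _).add_const _).mul_const _
  rw [zero_mul, zero_add] at hlim
  obtain ⟨n, hn⟩ := (hlim.eventually (eventually_lt_nhds hc')).exists
  exact hQ.mono _ _ _ _ (distQ_iterate hQ hT hη hη1 hα hβ hκ₁ hκ₂ hκ hε hεr htr htr' htu htu' ha0 hl0
    ha hb hl hm n k hk).2 hn.le

end firstBoth

/-! ## §11 The combined second-difference step, its iteration and the limit -/

section secondIterate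

variable {N : ℕ} {r α β σ η κ ε σ₂ a₁ a₂ a₁₂ b₁ b₂ b₁₂ l₁' l₂' l₁₂ m₁₂ D₁ D₂ : ℝ}
  {Q : ∀ k, F k → ℝ → Prop}
  {A : Bool → Bool → ∀ k, E k ≃L[ℝ] E (k + 1)} {B : Bool → Bool → ∀ k, F k →+ E (k + 1)}
  {S : Bool → Bool → ∀ k, E k → F k → F (k + 1)} {y₀ : Bool → Bool → F 0}
  {x : Bool → Bool → ∀ k, E k}

/-- **Iteration of the second-difference step** from the trivial bound `4ε`: after `n` steps the
weighted mixed second difference of the four tuned trajectories is at most `κ^n·4ε + Δ₂/(1−κ)`.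
[cite: AdamsBuchholzKoteckyMuller2019, Ch. 12, eqs. (12.43)–(12.46)] -/
theorem distQ2_iterate (hQ : IsSubaddNormBound Q)
    (hT : ∀ i j, IsRGStepQ N r α β σ Q (A i j) (B i j) (S i j))
    (hη : 0 < η) (hη1 : η ≤ 1) (hα : 0 ≤ α) (hβ : 0 ≤ β) (hκ₁ : α * (η + β) ≤ κ)
    (hκ₂ : σ ≤ κ * η) (hκ : κ < 1) (hε : 0 ≤ ε) (hεr : 3 * ε ≤ r)
    (htr : ∀ i j, IsTunedQ N (A i j) (B i j) (S i j) (y₀ i j) (x i j))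
    (htu : ∀ i j, InTubeQ N η ε Q (S i j) (y₀ i j) (x i j))
    (ha₁0 : 0 ≤ a₁) (ha₂0 : 0 ≤ a₂) (ha₁₂0 : 0 ≤ a₁₂) (hσ₂0 : 0 ≤ σ₂) (hD₁0 : 0 ≤ D₁) (hD₂0 : 0 ≤ D₂)
    (hΔ0 : 0 ≤ secondPertSize α β η ε σ₂ a₁ a₂ a₁₂ b₁ b₂ b₁₂ l₁' l₂' l₁₂ m₁₂ D₁ D₂)
    (ha₁ : ∀ j k, k < N → ∀ w : E (k + 1), ‖(A true j k).symm w - (A false j k).symm w‖ ≤ a₁ * ‖w‖)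
    (ha₂ : ∀ i k, k < N → ∀ w : E (k + 1), ‖(A i true k).symm w - (A i false k).symm w‖ ≤ a₂ * ‖w‖)
    (ha₁₂ : ∀ k, k < N → ∀ w : E (k + 1),
      ‖(A true true k).symm w - (A true false k).symm w - (A false true k).symm w + (A false false k).symm w‖
        ≤ a₁₂ * ‖w‖)
    (hb₁ : ∀ j k, k < N → ∀ (v : F k) (c : ℝ), Q k v c → ‖B true j k v - B false j k v‖ ≤ b₁ * c)
    (hb₂ : ∀ i k, k < N → ∀ (v : F k) (c : ℝ), Q k v c → ‖B i true k v - B i false k v‖ ≤ b₂ * c)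
    (hb₁₂ : ∀ k, k < N → ∀ (v : F k) (c : ℝ), Q k v c →
      ‖B true true k v - B true false k v - B false true k v + B false false k v‖ ≤ b₁₂ * c)
    (hl₁ : ∀ k, k < N → ∀ (u u' : E k) (v v' : F k) (cv cv' c : ℝ), ‖u‖ ≤ r → ‖u'‖ ≤ r →
      Q k v cv → cv ≤ r → Q k v' cv' → cv' ≤ r → Q k (v - v') c →
      Q (k + 1) ((S true false k u v - S false false k u v) - (S true false k u' v' - S false false k u' v'))
        (l₁' * max ‖u - u'‖ c))
    (hl₂ : ∀ k, k < N → ∀ (u u' : E k) (v v' : F k) (cv cv' c : ℝ), ‖u‖ ≤ r → ‖u'‖ ≤ r →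
      Q k v cv → cv ≤ r → Q k v' cv' → cv' ≤ r → Q k (v - v') c →
      Q (k + 1) ((S false true k u v - S false false k u v) - (S false true k u' v' - S false false k u' v'))
        (l₂' * max ‖u - u'‖ c))
    (hl₁₂ : ∀ k, k < N → ∀ (u : E k) (v : F k) (cv : ℝ), ‖u‖ ≤ r → Q k v cv → cv ≤ r →
      Q (k + 1) (S true true k u v - S true false k u v - S false true k u v + S false false k u v)
        (l₁₂ * max ‖u‖ cv))
    (hσ₂ : ∀ k, k < N → ∀ (u y z : E k) (v y' z' : F k) (cv cvy cvz cvyz cy cz : ℝ),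
      ‖u‖ ≤ r → ‖u + y‖ ≤ r → ‖u + z‖ ≤ r → ‖u + y + z‖ ≤ r →
      Q k v cv → cv ≤ r → Q k (v + y') cvy → cvy ≤ r → Q k (v + z') cvz → cvz ≤ r →
      Q k (v + y' + z') cvyz → cvyz ≤ r → Q k y' cy → Q k z' cz →
      Q (k + 1) (S false false k (u + y + z) (v + y' + z') - S false false k (u + y) (v + y')
          - S false false k (u + z) (v + z') + S false false k u v) (σ₂ * max ‖y‖ cy * max ‖z‖ cz))
    (hm₁₂ : Q 0 (y₀ true true - y₀ true false - y₀ false true + y₀ false false) m₁₂)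
    (hD₁ : ∀ j k, k ≤ N → ‖x true j k - x false j k‖ ≤ D₁ * η ^ k ∧
      Q k (fwd (S true j) (y₀ true j) (x true j) k - fwd (S false j) (y₀ false j) (x false j) k) (D₁ * η ^ k))
    (hD₂ : ∀ i k, k ≤ N → ‖x i true k - x i false k‖ ≤ D₂ * η ^ k ∧
      Q k (fwd (S i true) (y₀ i true) (x i true) k - fwd (S i false) (y₀ i false) (x i false) k) (D₂ * η ^ k))
    (n : ℕ) :
    ∀ k, k ≤ N →
      ‖x true true k - x true false k - x false true k + x false false k‖
        ≤ (κ ^ n * (4 * ε) + secondPertSize α β η ε σ₂ a₁ a₂ a₁₂ b₁ b₂ b₁₂ l₁' l₂' l₁₂ m₁₂ D₁ D₂ / (1 - κ)) * η ^ k ∧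
      Q k (fwd (S true true) (y₀ true true) (x true true) k - fwd (S true false) (y₀ true false) (x true false) k
        - fwd (S false true) (y₀ false true) (x false true) k + fwd (S false false) (y₀ false false) (x false false) k)
        ((κ ^ n * (4 * ε) + secondPertSize α β η ε σ₂ a₁ a₂ a₁₂ b₁ b₂ b₁₂ l₁' l₂' l₁₂ m₁₂ D₁ D₂ / (1 - κ)) * η ^ k) := by
  set Δ := secondPertSize α β η ε σ₂ a₁ a₂ a₁₂ b₁ b₂ b₁₂ l₁' l₂' l₁₂ m₁₂ D₁ D₂ with hΔ
  have hκ0 : 0 ≤ κ := le_trans (mul_nonneg hα (add_nonneg hη.le hβ)) hκ₁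
  have hΔ1 : 0 ≤ Δ / (1 - κ) := div_nonneg hΔ0 (by linarith)
  induction n with
  | zero =>
      intro k hk
      have hηk : 0 ≤ η ^ k := pow_nonneg hη.le k
      have hb4 : ‖x true true k - x true false k - x false true k + x false false k‖ ≤ 4 * ε * η ^ k ∧
          Q k (fwd (S true true) (y₀ true true) (x true true) k - fwd (S true false) (y₀ true false) (x true false) k
            - fwd (S false true) (y₀ false true) (x false true) k
            + fwd (S false false) (y₀ false false) (x false false) k) (4 * ε * η ^ k) := by
        constructor
        · calc ‖x true true k - x true false k - x false true k + x false false k‖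
              ≤ ‖x true true k - x true false k - x false true k‖ + ‖x false false k‖ := norm_add_le _ _
            _ ≤ ‖x true true k - x true false k‖ + ‖x false true k‖ + ‖x false false k‖ :=
                add_le_add (norm_sub_le _ _) le_rfl
            _ ≤ ‖x true true k‖ + ‖x true false k‖ + ‖x false true k‖ + ‖x false false k‖ :=
                add_le_add (add_le_add (norm_sub_le _ _) le_rfl) le_rfl
            _ ≤ ε * η ^ k + ε * η ^ k + ε * η ^ k + ε * η ^ k :=
                add_le_add (add_le_add (add_le_add (htu true true k hk).1 (htu true false k hk).1)
                  (htu false true k hk).1) (htu false false k hk).1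
            _ = 4 * ε * η ^ k := by ring
        · have h := hQ.add k _ _ _ _ (hQ.sub k _ _ _ _ (hQ.sub k _ _ _ _ (htu true true k hk).2
            (htu true false k hk).2) (htu false true k hk).2) (htu false false k hk).2
          rw [show ε * η ^ k + ε * η ^ k + ε * η ^ k + ε * η ^ k = 4 * ε * η ^ k by ring] at h
          exact h
      rw [pow_zero, one_mul]
      exact ⟨hb4.1.trans (mul_le_mul_of_nonneg_right (le_add_of_nonneg_right hΔ1) hηk),
        hQ.mono _ _ _ _ hb4.2 (mul_le_mul_of_nonneg_right (le_add_of_nonneg_right hΔ1) hηk)⟩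
  | succ n ih =>
      have hDn0 : 0 ≤ κ ^ n * (4 * ε) + Δ / (1 - κ) :=
        add_nonneg (mul_nonneg (pow_nonneg hκ0 n) (by linarith)) hΔ1
      have hrel := distQ2_step_rel hT hη hα hβ hκ₁ htr htu ha₁0 ha₂0 ha₁₂0 hΔ0 ha₁ ha₂ ha₁₂ hb₁ hb₂ hb₁₂
        hD₁ hD₂ hDn0 ih
      have hirr := distQ2_step_irrel (a₁ := a₁) (a₂ := a₂) (a₁₂ := a₁₂) (b₁ := b₁) (b₂ := b₂) (b₁₂ := b₁₂)
        hQ hT hη hη1 hκ0 hκ₂ hε hεr htu hσ₂0 hD₁0 hD₂0 hl₁ hl₂ hl₁₂ hσ₂ hm₁₂ hD₁ hD₂ hDn0 ih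
      have hid : κ * (κ ^ n * (4 * ε) + Δ / (1 - κ)) + Δ = κ ^ (n + 1) * (4 * ε) + Δ / (1 - κ) := by
        have h1 : (1 - κ) ≠ 0 := by linarith
        field_simp
        ring
      intro k hk
      have h1 := hrel k hk
      have h2 := hirr k hk
      rw [hid] at h1 h2
      exact ⟨h1, h2⟩

/-- **Bounded mixed second differences of the tuned trajectories** ([ABKM19] Thm 12.1, smoothness
content in difference form): under the hypotheses of `distQ2_iterate` and for predicates closed from
above in the bound, `‖x^{11}_k − x^{10}_k − x^{01}_k + x^{00}_k‖ ≤ η^k Δ₂/(1−κ)` and the same bound for the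
irrelevant coordinates, `k ≤ N`. [cite: AdamsBuchholzKoteckyMuller2019, Thm 12.1] -/
theorem secondDiff_le_of_isTunedQ (hQ : IsSubaddNormBound Q)
    (hQc : ∀ k (y : F k) (c : ℝ), (∀ c', c < c' → Q k y c') → Q k y c)
    (hT : ∀ i j, IsRGStepQ N r α β σ Q (A i j) (B i j) (S i j))
    (hη : 0 < η) (hη1 : η ≤ 1) (hα : 0 ≤ α) (hβ : 0 ≤ β) (hκ₁ : α * (η + β) ≤ κ)
    (hκ₂ : σ ≤ κ * η) (hκ : κ < 1) (hε : 0 ≤ ε) (hεr : 3 * ε ≤ r)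
    (htr : ∀ i j, IsTunedQ N (A i j) (B i j) (S i j) (y₀ i j) (x i j))
    (htu : ∀ i j, InTubeQ N η ε Q (S i j) (y₀ i j) (x i j))
    (ha₁0 : 0 ≤ a₁) (ha₂0 : 0 ≤ a₂) (ha₁₂0 : 0 ≤ a₁₂) (hσ₂0 : 0 ≤ σ₂) (hD₁0 : 0 ≤ D₁) (hD₂0 : 0 ≤ D₂)
    (hΔ0 : 0 ≤ secondPertSize α β η ε σ₂ a₁ a₂ a₁₂ b₁ b₂ b₁₂ l₁' l₂' l₁₂ m₁₂ D₁ D₂)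
    (ha₁ : ∀ j k, k < N → ∀ w : E (k + 1), ‖(A true j k).symm w - (A false j k).symm w‖ ≤ a₁ * ‖w‖)
    (ha₂ : ∀ i k, k < N → ∀ w : E (k + 1), ‖(A i true k).symm w - (A i false k).symm w‖ ≤ a₂ * ‖w‖)
    (ha₁₂ : ∀ k, k < N → ∀ w : E (k + 1),
      ‖(A true true k).symm w - (A true false k).symm w - (A false true k).symm w + (A false false k).symm w‖
        ≤ a₁₂ * ‖w‖)
    (hb₁ : ∀ j k, k < N → ∀ (v : F k) (c : ℝ), Q k v c → ‖B true j k v - B false j k v‖ ≤ b₁ * c)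
    (hb₂ : ∀ i k, k < N → ∀ (v : F k) (c : ℝ), Q k v c → ‖B i true k v - B i false k v‖ ≤ b₂ * c)
    (hb₁₂ : ∀ k, k < N → ∀ (v : F k) (c : ℝ), Q k v c →
      ‖B true true k v - B true false k v - B false true k v + B false false k v‖ ≤ b₁₂ * c)
    (hl₁ : ∀ k, k < N → ∀ (u u' : E k) (v v' : F k) (cv cv' c : ℝ), ‖u‖ ≤ r → ‖u'‖ ≤ r →
      Q k v cv → cv ≤ r → Q k v' cv' → cv' ≤ r → Q k (v - v') c →
      Q (k + 1) ((S true false k u v - S false false k u v) - (S true false k u' v' - S false false k u' v'))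
        (l₁' * max ‖u - u'‖ c))
    (hl₂ : ∀ k, k < N → ∀ (u u' : E k) (v v' : F k) (cv cv' c : ℝ), ‖u‖ ≤ r → ‖u'‖ ≤ r →
      Q k v cv → cv ≤ r → Q k v' cv' → cv' ≤ r → Q k (v - v') c →
      Q (k + 1) ((S false true k u v - S false false k u v) - (S false true k u' v' - S false false k u' v'))
        (l₂' * max ‖u - u'‖ c))
    (hl₁₂ : ∀ k, k < N → ∀ (u : E k) (v : F k) (cv : ℝ), ‖u‖ ≤ r → Q k v cv → cv ≤ r →
      Q (k + 1) (S true true k u v - S true false k u v - S false true k u v + S false false k u v)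
        (l₁₂ * max ‖u‖ cv))
    (hσ₂ : ∀ k, k < N → ∀ (u y z : E k) (v y' z' : F k) (cv cvy cvz cvyz cy cz : ℝ),
      ‖u‖ ≤ r → ‖u + y‖ ≤ r → ‖u + z‖ ≤ r → ‖u + y + z‖ ≤ r →
      Q k v cv → cv ≤ r → Q k (v + y') cvy → cvy ≤ r → Q k (v + z') cvz → cvz ≤ r →
      Q k (v + y' + z') cvyz → cvyz ≤ r → Q k y' cy → Q k z' cz →
      Q (k + 1) (S false false k (u + y + z) (v + y' + z') - S false false k (u + y) (v + y')
          - S false false k (u + z) (v + z') + S false false k u v) (σ₂ * max ‖y‖ cy * max ‖z‖ cz))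
    (hm₁₂ : Q 0 (y₀ true true - y₀ true false - y₀ false true + y₀ false false) m₁₂)
    (hD₁ : ∀ j k, k ≤ N → ‖x true j k - x false j k‖ ≤ D₁ * η ^ k ∧
      Q k (fwd (S true j) (y₀ true j) (x true j) k - fwd (S false j) (y₀ false j) (x false j) k) (D₁ * η ^ k))
    (hD₂ : ∀ i k, k ≤ N → ‖x i true k - x i false k‖ ≤ D₂ * η ^ k ∧
      Q k (fwd (S i true) (y₀ i true) (x i true) k - fwd (S i false) (y₀ i false) (x i false) k) (D₂ * η ^ k)) :
    ∀ k, k ≤ N →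
      ‖x true true k - x true false k - x false true k + x false false k‖
        ≤ secondPertSize α β η ε σ₂ a₁ a₂ a₁₂ b₁ b₂ b₁₂ l₁' l₂' l₁₂ m₁₂ D₁ D₂ / (1 - κ) * η ^ k ∧
      Q k (fwd (S true true) (y₀ true true) (x true true) k - fwd (S true false) (y₀ true false) (x true false) k
        - fwd (S false true) (y₀ false true) (x false true) k + fwd (S false false) (y₀ false false) (x false false) k)
        (secondPertSize α β η ε σ₂ a₁ a₂ a₁₂ b₁ b₂ b₁₂ l₁' l₂' l₁₂ m₁₂ D₁ D₂ / (1 - κ) * η ^ k) := by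
  set Δ := secondPertSize α β η ε σ₂ a₁ a₂ a₁₂ b₁ b₂ b₁₂ l₁' l₂' l₁₂ m₁₂ D₁ D₂ with hΔ
  have hκ0 : 0 ≤ κ := le_trans (mul_nonneg hα (add_nonneg hη.le hβ)) hκ₁
  have hit := distQ2_iterate hQ hT hη hη1 hα hβ hκ₁ hκ₂ hκ hε hεr htr htu ha₁0 ha₂0 ha₁₂0 hσ₂0 hD₁0 hD₂0
    hΔ0 ha₁ ha₂ ha₁₂ hb₁ hb₂ hb₁₂ hl₁ hl₂ hl₁₂ hσ₂ hm₁₂ hD₁ hD₂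
  intro k hk
  have hlim : Tendsto (fun n : ℕ => (κ ^ n * (4 * ε) + Δ / (1 - κ)) * η ^ k) atTop
      (𝓝 ((0 * (4 * ε) + Δ / (1 - κ)) * η ^ k)) :=
    (((tendsto_pow_atTop_nhds_zero_of_lt_one hκ0 hκ).mul_const _).add_const _).mul_const _
  rw [zero_mul, zero_add] at hlim
  refine ⟨ge_of_tendsto' hlim fun n => (hit n k hk).1, hQc _ _ _ fun c' hc' => ?_⟩
  obtain ⟨n, hn⟩ := (hlim.eventually (eventually_lt_nhds hc')).exists
  exact hQ.mono _ _ _ _ (hit n k hk).2 hn.le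

end secondIterate

end RGFlow

end Literature.Dynamics.Hyperbolic

end
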